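import Summits.HodgeConjecture.HodgeConjecture.Theorems.AnchorTransportVariationalHodgePadicGrothendieckExistenceUnitBoundStepII

/-!
# Grothendieck's existence theorem for vector bundles on proper `W(k)`-schemes — the named facts hold

Row b03 / crux `AnchorTransport.VariationalHodge` (stmt-HodgeConjecture-1076), line padic-disc-transport,
STUB P (`…_of_grothendieckExistence` rungs). With Grothendieck's existence theorem for proper schemes
in the kernel (`GrothendieckExistenceProper.exists_coh_iso_cmplTower_of_isProper`,
`…GrothendieckExistenceUnitBoundStepII`), the vector-bundle form follows exactly as in the projective
case (`Motives/GrothendieckExistenceWittProjective`): the direct images `ι_{n+1*}E_n` of a compatible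
system of vector bundles on the thickenings `𝒳 ⊗ W/pⁿ⁺¹` form a coherent formal tower along `p`
(`coh_tower_of_formalVectorBundle`), its algebraization `F` is a vector bundle with `F|_{X_{n+1}} ≅ E_n`
(`isVectorBundle_and_iso_of_cokernelIsos`, `pullbackThickeningιIso`).

* `exists_isVectorBundle_forall_pullback_thickeningι_iso` — GW II Thm. 24.94 + Prop. 24.95 for vector
  bundles on EVERY proper `𝒳 / W(k)` (`k` perfect of characteristic `p`, any universe), all levels;
* **`GrothendieckExistence_vectorBundle_witt_holds : Motives.GrothendieckExistence_vectorBundle_witt`**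
  and **`GortzWedhorn2023_prop2495_wittVector_holds : FormalGeometry.GortzWedhorn2023_prop2495_wittVector`**
  — the two Literature named facts are THEOREMS.

HONEST FRAMING: research route conditional on HC_CM; not a corollary; Q11.4-sentence-2 already
refuted in dim ≥ 3. Nothing here bears on `HC_CM`; no case of the Hodge conjecture is proved.

References: GortzWedhorn2023 (II: Thm. 24.94, Prop. 24.95, Lemma 24.96, pp. 566–567); EGAIII1
(Thm. 5.1.4, Cor. 5.2.4); StacksProject (Tag 088C).
-/

set_option linter.dupNamespace false

noncomputable section

-- Summit.HodgeConjecture.HodgeConjecture.… repeats the summit name by the D-0017 layout (Sub = Summit).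

-- `TopCat.Presheaf`/`Scheme.Modules` are not reducible (as in Mathlib's `AlgebraicGeometry/Modules`).
set_option backward.isDefEq.respectTransparency false

open CategoryTheory CategoryTheory.Limits AlgebraicGeometry TopologicalSpace Opposite
open Literature.AlgebraicGeometry.Modules Literature.AlgebraicGeometry.Morphisms
open Literature.AlgebraicGeometry.Motives Literature.AlgebraicGeometry.Motives.WittScheme

universe u

namespace Summit.HodgeConjecture.HodgeConjecture.Theorems

namespace GrothendieckExistenceProper

/-- **Grothendieck's existence theorem for vector bundles on a PROPER `W(k)`-scheme** (GW II
Thm. 24.94 with Prop. 24.95, general proper case; no smoothness, flatness or projectivity): for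
`𝒳 / W(k)` proper (`k` perfect of characteristic `p`) and vector bundles `E_n` on the thickenings
`X_{n+1} = 𝒳 ⊗_W W/pⁿ⁺¹` with `E_{n+1}|_{X_{n+1}} ≅ E_n`, there is a vector bundle `F` on `𝒳` with
`E_n ≅ F|_{X_{n+1}}` for all `n`. -/
theorem exists_isVectorBundle_forall_pullback_thickeningι_iso {p : ℕ} [Fact p.Prime] {k : Type u}
    [Field k] [CharP k p] [PerfectRing k p] (𝒳 : SchemeOver (WittVector p k)) [IsProper 𝒳.hom]
    (E : ∀ n : ℕ, (thickening 𝒳 (n + 1)).left.Modules) (hE : ∀ n, IsVectorBundle (E n))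
    (hcompat : ∀ n, Nonempty ((Scheme.Modules.pullback
      (thickeningMap 𝒳 (Nat.le_succ (n + 1)))).obj (E (n + 1)) ≅ E n)) :
    ∃ F : 𝒳.left.Modules, IsVectorBundle F ∧
      ∀ n : ℕ, Nonempty (E n ≅ (Scheme.Modules.pullback (thickeningι 𝒳 (n + 1))).obj F) := by
  haveI : IsLocallyNoetherian 𝒳.left := LocallyOfFiniteType.isLocallyNoetherian 𝒳.hom
  -- the direct-image tower `M_n = ι_{n+1*} E_n` along `a = p·1`
  obtain ⟨hcoh, hkill, htrans⟩ := coh_tower_of_formalVectorBundle 𝒳 E hE hcompat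
  have hpow : ∀ m, algebraMapΓ 𝒳.hom ((p : WittVector p k) ^ m) =
      algebraMapΓ 𝒳.hom (p : WittVector p k) ^ m := algebraMapΓ_pow 𝒳
  let a : Γ(𝒳.left, ⊤) := algebraMapΓ 𝒳.hom (p : WittVector p k)
  let M : ℕ → 𝒳.left.Modules := fun n =>
    (Scheme.Modules.pushforward (thickeningι 𝒳 (n + 1))).obj (E n)
  let β : ∀ n, cokernel (globalScalar (M (n + 1)) (a ^ (n + 1))) ≅ M n := fun n =>
    cokernelIsoOfEq (by rw [hpow]) ≪≫ (htrans n).some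
  have hk' : ∀ n, globalScalar (M n) (a ^ (n + 1)) = 0 := fun n => by rw [← hpow]; exact hkill n
  have hT : IsFormalTower a (towerOfIsos a M β) := IsFormalTower.ofIsos _ M β hk'
  have hTc : ∀ n, Coh ((towerOfIsos a M β).obj ⟨n⟩) := fun n => hcoh n
  -- algebraize the tower: Grothendieck's existence theorem for the proper `𝒳`
  obtain ⟨F, hF, ⟨eF⟩⟩ := exists_coh_iso_cmplTower_of_isProper 𝒳.hom (p : WittVector p k) hT hTc
  have hFfp : SheafOfModules.IsFinitePresentation.{u, u, u} F := isFinitePresentation_of_coh F hF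
  -- levelwise `F/pⁿ⁺¹F ≅ ι_{n+1*} E_n`, and back to the restriction model
  have β' : ∀ n, cokernel (globalScalar F (algebraMapΓ 𝒳.hom ((p : WittVector p k) ^ (n + 1)))) ≅
      (Scheme.Modules.pushforward (thickeningι 𝒳 (n + 1))).obj (E n) := fun n =>
    cokernelIsoOfEq (by rw [hpow]) ≪≫ eF.app ⟨n⟩
  obtain ⟨hFvb, -⟩ := isVectorBundle_and_iso_of_cokernelIsos 𝒳 E hE F hFfp β'
  exact ⟨F, hFvb, fun n => ⟨(pullbackThickeningιIso (n + 1) F (β' n)).symm⟩⟩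

/-- **`Motives.GrothendieckExistence_vectorBundle_witt` is a theorem** (Görtz–Wedhorn II Thm. 24.94
with Prop. 24.95 — Grothendieck's existence theorem for vector bundles — for EVERY proper
`𝒳 / W(k)`, `k` perfect of characteristic `p`, in every universe): a compatible system of vector
bundles on the thickenings `𝒳 ⊗ W/pⁿ⁺¹` is, at level `1`, the restriction of a vector bundle on `𝒳`. -/
theorem GrothendieckExistence_vectorBundle_witt_holds : GrothendieckExistence_vectorBundle_witt.{u} := by
  intro p _ k _ _ _ 𝒳 h𝒳 E hE hstep
  haveI := h𝒳
  obtain ⟨F, hF, e⟩ := exists_isVectorBundle_forall_pullback_thickeningι_iso 𝒳 E hE hstep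
  exact ⟨F, hF, ⟨(e 0).some.symm⟩⟩

/-- **`FormalGeometry.GortzWedhorn2023_prop2495_wittVector` is a theorem** (GW II Prop. 24.95 for
proper `W(k)`-schemes, the `FormalGeometry` vendored form; equivalent to the universe-`0` `Motives`
form by `GortzWedhorn2023_prop2495_wittVector_iff_grothendieckExistence_vectorBundle_witt`). -/
theorem GortzWedhorn2023_prop2495_wittVector_holds :
    Literature.AlgebraicGeometry.FormalGeometry.GortzWedhorn2023_prop2495_wittVector :=
  Literature.AlgebraicGeometry.FormalGeometry.GortzWedhorn2023_prop2495_wittVector.of_grothendieckExistence_vectorBundle_witt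
    GrothendieckExistence_vectorBundle_witt_holds.{0}

end GrothendieckExistenceProper

end Summit.HodgeConjecture.HodgeConjecture.Theorems

end
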